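import Mathlib.Analysis.LocallyConvex.WithSeminorms
import Mathlib.MeasureTheory.Measure.CharacteristicFunction.Basic
import Mathlib.Analysis.Distribution.SchwartzSpace.Basic
import Mathlib.MeasureTheory.Integral.Bochner.ContinuousLinearMap
import Literature.MathematicalPhysics.QuantumLattice.RandomField
import HarnessLib

-- provenance: harness21/H21/H21/Prelude/AnalysisL/NuclearSpace.lean @ e290bd2 (interim HEAD d8f2665); M5 mechanical rewrite
/-!
# Nuclear spaces, positive-definite functions and the finite-dimensional Bochner theorem

Trunk **T-AQFT** (G28 AnalysisL, Part A, item P1), notion `nuclear_space_minlos`.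

This file provides the generic (root-`Literature`) vocabulary consumed by the Minlos–Sazonov item (P2):

* `Literature.IsPositiveDefinite C` for a function `C : G → ℂ` on an additive group: for all finite
  families `xᵢ` and complex coefficients `cᵢ`, `∑ᵢⱼ conj cᵢ * cⱼ * C (xⱼ - xᵢ)` is a nonnegative real.
  The index order is *literally* that of the accepted `Literature.MathematicalPhysics.QuantumLattice.IsPositiveDefiniteFunctional`
  (the case `G = 𝓢(E, ℝ)`), whence the `Iff.rfl` bridge `Literature.Analysis.FunctionSpaces.isPositiveDefiniteFunctional_iff`.
  API: `apply_zero_im`, `apply_zero_re_nonneg`, `norm_apply_le`, `conj_neg`,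
  `isPositiveDefinite_one`, `isPositiveDefinite_charFun` (the easy half of Bochner, real proof).
* `Literature.Analysis.FunctionSpaces.bochner`: Bochner's theorem on a finite-dimensional real inner product space, phrased with
  Mathlib's `MeasureTheory.charFun μ t = ∫ x, exp (⟪x, t⟫ i) ∂μ`; existence
  (`exists_charFun_eq`) is sorried, uniqueness is derived from Mathlib's `Measure.ext_of_charFun`.
* `Literature.NuclearSpace 𝕜 E`: a `Prop`-valued class, nuclearity of a topological vector space in
  Pietsch's intrinsic seminorm form (every continuous seminorm is dominated by a *nuclear*
  seminorm `x ↦ ∑ₙ ‖φₙ x‖` with `‖φₙ x‖ ≤ cₙ q x`, `∑ cₙ < ∞`, `q` continuous), and the standard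
  sorried theorems: finite-dimensional spaces are nuclear, `𝓢(E, F)` is nuclear and separable,
  infinite-dimensional normed spaces are not nuclear, products, and closed subspaces of locally
  convex nuclear spaces. The class is only meaningful for locally convex spaces (see its
  docstring).

## Sources

* S. Bochner, *Monotone Funktionen, Stieltjessche Integrale und harmonische Analyse*, Math. Ann.
  108 (1933), 378–410 (Bochner's theorem).
* A. Grothendieck, *Produits tensoriels topologiques et espaces nucléaires*, Mem. AMS 16 (1955).
* A. Pietsch, *Nuclear locally convex spaces* (Springer, 1972), Prop. 4.1.4 (seminorm form of
  nuclearity), §5.1 (subspaces), §5.2 (products).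
* F. Trèves, *Topological vector spaces, distributions and kernels* (1967), §50 (Def. 50.1,
  Prop. 50.1, Cor. 2 of Prop. 50.2), §51 (Thm 51.5: `𝒮` is nuclear).
* I. M. Gel'fand, N. Ya. Vilenkin, *Generalized Functions IV* (1964), Ch. I §3.2 (countably-Hilbert
  nuclear spaces), Ch. IV §3 (Minlos), §3.6 (Hermite expansion in `𝒮`).

## Mathlib

Used: `Seminorm`, `E →L[𝕜] 𝕜`, `Summable`, `MeasureTheory.charFun`, `charFun_neg`,
`norm_charFun_le`, `Measure.ext_of_charFun`, `SchwartzMap` (`𝓢(E, F)` with its Fréchet topology and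
`instFirstCountableTopology`). Verified absent at the pin (`lean_search`): positive-definite
functions on groups (`PositiveDefinite` only occurs for matrices as `Matrix.PosDef`), Bochner's
theorem, nuclear spaces/operators, `SeparableSpace 𝓢(E, F)`.

## Design

* `IsPositiveDefinite` is stated on an arbitrary `AddGroup` and with values in `ℂ`, recording
  positivity as `0 ≤ re ∧ im = 0` (rather than via the `PartialOrder ℂ` scope) to match the accepted
  `AQFT.IsPositiveDefiniteFunctional` definitionally.
* `NuclearSpace` is a `class` because nuclearity is a canonical property of a TVS (like
  `LocallyConvexSpace`); this file registers NO instances — all nuclearity results are theorems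
  (mostly sorried), to be used via `haveI`. The Hilbert–Schmidt / countably-Hilbert form of
  Gel'fand–Vilenkin (IV §3.2; equivalently Grothendieck's: every continuous linear map into a Banach
  space is nuclear, Trèves Thm 50.1) is equivalent for locally convex spaces and is recorded in the
  docstring only.
* In `NuclearSpace` the dominating series `∑' n, ‖φ n x‖` would be Mathlib's junk value `0` for a
  non-summable family, but summability *follows* from the preceding conjunct
  `‖φ n x‖ ≤ c n * q x` with `Summable c` (`NuclearSpace.summable_norm_apply`, real proof), so the
  definition is honest.
-/

open scoped SchwartzMap ComplexConjugate NNReal InnerProductSpace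
open MeasureTheory Filter Topology Complex

namespace Literature.Analysis.FunctionSpaces

/-! ### Positive-definite functions on additive groups -/

section PositiveDefinite

variable {G : Type*} [AddGroup G]

/-- A function `C : G → ℂ` on an additive group is *positive definite* if for every finite family
`x : Fin n → G` and coefficients `c : Fin n → ℂ` the Hermitian form
`∑ᵢ ∑ⱼ conj (cᵢ) * cⱼ * C (xⱼ - xᵢ)` is a nonnegative real number. Bochner 1933 §1;
Gel'fand–Vilenkin IV, Ch. II §3.1. Same index order as `Literature.MathematicalPhysics.QuantumLattice.IsPositiveDefiniteFunctional`. [cite: Bochner1933, §1] -/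
def IsPositiveDefinite (C : G → ℂ) : Prop :=
  ∀ (n : ℕ) (x : Fin n → G) (c : Fin n → ℂ),
    0 ≤ (∑ i, ∑ j, conj (c i) * c j * C (x j - x i)).re ∧
      (∑ i, ∑ j, conj (c i) * c j * C (x j - x i)).im = 0

namespace IsPositiveDefinite

variable {C : G → ℂ}

/-- A positive-definite function is real at `0`: `im (C 0) = 0` (take `n = 1`, `c = 1`).
Gel'fand–Vilenkin IV, Ch. II §3.1, property 1. [folklore] -/
theorem apply_zero_im (hC : IsPositiveDefinite C) : (C 0).im = 0 := by
  simpa using (hC 1 (fun _ => 0) (fun _ => 1)).2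

/-- A positive-definite function is nonnegative at `0`: `0 ≤ re (C 0)` (take `n = 1`, `c = 1`).
Gel'fand–Vilenkin IV, Ch. II §3.1, property 1. [folklore] -/
theorem apply_zero_re_nonneg (hC : IsPositiveDefinite C) : 0 ≤ (C 0).re := by
  simpa using (hC 1 (fun _ => 0) (fun _ => 1)).1

/-- Hermitian symmetry of a positive-definite function: `C (-x) = conj (C x)` (take `n = 2`).
Gel'fand–Vilenkin IV, Ch. II §3.1, property 2; Bochner 1933 §1. [cite: Bochner1933, §1] -/
def conj_neg : Prop :=
  ∀ (hC : IsPositiveDefinite C) (x : G),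
    C (-x) = conj (C x)

/-- A positive-definite function is bounded by its value at `0`: `‖C x‖ ≤ re (C 0)` (the `2 × 2`
determinant inequality). Gel'fand–Vilenkin IV, Ch. II §3.1, property 3; Bochner 1933 §1. [cite: Bochner1933, §1] -/
def norm_apply_le : Prop :=
  ∀ (hC : IsPositiveDefinite C) (x : G),
    ‖C x‖ ≤ (C 0).re

end IsPositiveDefinite

/-- The constant function `1` is positive definite:
`∑ᵢⱼ conj cᵢ cⱼ = |∑ᵢ cᵢ|² ≥ 0`. (It is the characteristic function of the Dirac mass at `0`.)
Gel'fand–Vilenkin IV, Ch. II §3.1. [folklore] -/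
theorem isPositiveDefinite_one : IsPositiveDefinite (1 : G → ℂ) := by
  intro n x c
  have h : (∑ i, ∑ j, conj (c i) * c j * (1 : G → ℂ) (x j - x i)) =
      ((Complex.normSq (∑ i, c i) : ℝ) : ℂ) := by
    simp only [Pi.one_apply, ← Finset.mul_sum, ← Finset.sum_mul, ← Complex.mul_conj,
      map_sum, mul_comm, one_mul]
  rw [h]
  exact ⟨by simpa using Complex.normSq_nonneg _, by simp⟩

end PositiveDefinite

/-! ### Characteristic functions and Bochner's theorem -/

section Bochner

variable {E : Type*} [NormedAddCommGroup E] [InnerProductSpace ℝ E] [MeasurableSpace E]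
  [BorelSpace E]

/-- The characteristic function `t ↦ ∫ exp (i⟪x, t⟫) dμ(x)` (Mathlib's `charFun`) of a finite
measure is positive definite: `∑ᵢⱼ conj cᵢ cⱼ φ(tⱼ - tᵢ) = ∫ |∑ⱼ cⱼ e^{i⟪x,tⱼ⟫}|² dμ ≥ 0`.
The easy half of Bochner's theorem (Bochner 1933 §1). [cite: Bochner1933, §1] -/
theorem isPositiveDefinite_charFun (μ : Measure E) [IsFiniteMeasure μ] :
    IsPositiveDefinite (charFun μ) := by
  intro n x c
  set e : Fin n → E → ℂ := fun j y => cexp (⟪y, x j⟫_ℝ * I) with he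
  have hnorm : ∀ j y, ‖e j y‖ = 1 := fun j y => by
    simp only [he]
    rw [Complex.norm_exp_ofReal_mul_I]
  set F : Fin n → Fin n → E → ℂ := fun i j y => conj (c i) * c j * (e j y * conj (e i y)) with hF
  have hint : ∀ i j, Integrable (F i j) μ := fun i j => by
    refine (integrable_const (‖c i‖ * ‖c j‖)).mono' (by fun_prop)
      (Filter.Eventually.of_forall fun y => ?_)
    simp only [hF, norm_mul, Complex.norm_conj, hnorm, mul_one, le_refl]
  have hkey : (∑ i, ∑ j, conj (c i) * c j * charFun μ (x j - x i)) =
      ∫ y, ((Complex.normSq (∑ j, c j * e j y) : ℝ) : ℂ) ∂μ := by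
    have h1 : ∀ i j, conj (c i) * c j * charFun μ (x j - x i) = ∫ y, F i j y ∂μ := by
      intro i j
      rw [charFun_apply, hF, integral_const_mul]
      congr 1
      refine integral_congr_ae (Filter.Eventually.of_forall fun y => ?_)
      simp only [he, ← Complex.exp_conj, map_mul, Complex.conj_ofReal, Complex.conj_I,
        ← Complex.exp_add, inner_sub_right, ofReal_sub]
      ring_nf
    have h2 : ∀ i, ∑ j, ∫ y, F i j y ∂μ = ∫ y, ∑ j, F i j y ∂μ := fun i =>
      (integral_finsetSum _ (fun j _ => hint i j)).symm
    simp_rw [h1, h2]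
    rw [← integral_finsetSum _ (fun i _ => integrable_finsetSum _ fun j _ => hint i j)]
    refine integral_congr_ae (Filter.Eventually.of_forall fun y => ?_)
    simp only [hF]
    rw [← Complex.mul_conj, map_sum, Finset.sum_mul_sum, Finset.sum_comm]
    refine Finset.sum_congr rfl fun i _ => Finset.sum_congr rfl fun j _ => ?_
    simp only [map_mul]
    ring
  rw [hkey, integral_complex_ofReal]
  exact ⟨by simpa using integral_nonneg fun y => Complex.normSq_nonneg _, by simp⟩

/-- **Bochner's theorem, existence half** on a finite-dimensional real inner product space: a
continuous positive-definite `C : E → ℂ` with `C 0 = 1` is the characteristic function of a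
(Borel) probability measure. Bochner, Math. Ann. 108 (1933), Satz 22 (for `ℝ`; `ℝⁿ` in
Bochner–Chandrasekharan 1949); not in Mathlib at the pin. [cite: BochnerChandrasekharan1949] -/
def IsPositiveDefinite.exists_charFun_eq : Prop :=
  ∀ [FiniteDimensional ℝ E] {C : E → ℂ} (hp : IsPositiveDefinite C) (hc : Continuous C) (h0 : C 0 = 1),
    ∃ μ : Measure E, IsProbabilityMeasure μ ∧ charFun μ = C

/-- **Bochner's theorem** on a finite-dimensional real inner product space: continuous
positive-definite functions `C` with `C 0 = 1` are exactly the characteristic functions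
`charFun μ` of probability measures, and `μ` is unique. Existence is
`IsPositiveDefinite.exists_charFun_eq` (Bochner 1933); uniqueness is Mathlib's
`Measure.ext_of_charFun` (Lévy). [cite: Bochner1933] -/
def bochner : Prop :=
  ∀ [FiniteDimensional ℝ E] (C : E → ℂ) (hc : Continuous C) (hp : IsPositiveDefinite C) (h0 : C 0 = 1),
    ∃! μ : Measure E, IsProbabilityMeasure μ ∧ charFun μ = C

/- interim proof relied on results that are now named facts (D-0014); demoted to a fact by the M5 import, proof preserved:
:= by
  obtain ⟨μ, hμ, hμC⟩ := hp.exists_charFun_eq hc h0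
  haveI : CompleteSpace E := FiniteDimensional.complete ℝ E
  refine ⟨μ, ⟨hμ, hμC⟩, fun ν ⟨hν, hνC⟩ => ?_⟩
  exact Measure.ext_of_charFun (hνC.trans hμC.symm)
-/

end Bochner

end Literature.Analysis.FunctionSpaces

/-! ### Bridge to the accepted Schwartz-space vocabulary -/

namespace Literature.Analysis.FunctionSpaces

variable {E : Type*} [NormedAddCommGroup E] [NormedSpace ℝ E]

/-- The accepted `AQFT.IsPositiveDefiniteFunctional` (RandomField, Gel'fand–Vilenkin IV §3) is
literally the case `G = 𝓢(E, ℝ)` of the generic `Literature.Analysis.FunctionSpaces.IsPositiveDefinite`. [folklore] -/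
theorem isPositiveDefiniteFunctional_iff (C : 𝓢(E, ℝ) → ℂ) :
    Literature.MathematicalPhysics.QuantumLattice.IsPositiveDefiniteFunctional C ↔ IsPositiveDefinite C :=
  Iff.rfl

end Literature.Analysis.FunctionSpaces

namespace Literature.Analysis.FunctionSpaces

/-! ### Nuclear spaces -/

section Nuclear

/-- A topological vector space `E` over `𝕜 = ℝ` or `ℂ` is *nuclear* if every continuous seminorm
`p` is dominated by a *nuclear seminorm*: there are a continuous seminorm `q`, continuous linear
functionals `φₙ : E →L[𝕜] 𝕜` and a summable sequence `cₙ ≥ 0` with `‖φₙ x‖ ≤ cₙ q x` and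
`p x ≤ ∑ₙ ‖φₙ x‖` for all `x`. This is Pietsch's intrinsic characterisation (Pietsch 1972,
Prop. 4.1.4), equivalent for locally convex `E` to Grothendieck's definition (every continuous
linear map into a Banach space is nuclear; Grothendieck 1955, Trèves Def. 50.1 / Thm 50.1) and to
the Gel'fand–Vilenkin countably-Hilbert form (the topology is given by Hilbert seminorms `pₖ` such
that each inclusion of completions `Ê_{k+1} → Ê_k` is Hilbert–Schmidt; GV IV Ch. I §3.2) — these
equivalences are recorded here, not formalised.

*Vacuity caveat.* The class quantifies over continuous seminorms only, so it is meaningful only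
for locally convex `E` (which every consumer assumes, e.g. `minlos` via `[LocallyConvexSpace ℝ V]`):
a non-locally-convex TVS with no nonzero continuous seminorm (e.g. `L^p[0,1]`, `0 < p < 1`)
satisfies it vacuously.

The series `∑' n, ‖φ n x‖` would be Mathlib's junk value `0` if not summable, but summability
follows from the domination conjunct and `Summable c` (`NuclearSpace.summable_norm_apply`), so the
last conjunct is an honest inequality. This file registers no instances of the class. [cite: Pietsch1972, Prop. 4.1.4] -/
class NuclearSpace (𝕜 : Type*) (E : Type*) [RCLike 𝕜] [AddCommGroup E] [Module 𝕜 E]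
    [TopologicalSpace E] : Prop where
  /-- Every continuous seminorm is dominated by a nuclear seminorm (Pietsch 1972, Prop. 4.1.4). -/
  exists_nuclear_dominating : ∀ p : Seminorm 𝕜 E, Continuous p →
    ∃ q : Seminorm 𝕜 E, Continuous q ∧ ∃ (φ : ℕ → E →L[𝕜] 𝕜) (c : ℕ → ℝ≥0),
      Summable c ∧ (∀ n x, ‖φ n x‖ ≤ c n * q x) ∧ ∀ x, p x ≤ ∑' n, ‖φ n x‖

namespace NuclearSpace

variable {𝕜 : Type*} {E : Type*} [RCLike 𝕜] [AddCommGroup E] [Module 𝕜 E] [TopologicalSpace E]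

/-- The domination `‖φₙ x‖ ≤ cₙ q x` with `∑ cₙ < ∞` appearing in `NuclearSpace` makes the
dominating series `∑ₙ ‖φₙ x‖` summable, so `∑'` in the definition is not a junk value.
(Comparison test; Pietsch 1972 §4.1.) [cite: Pietsch1972, §4.1] -/
theorem summable_norm_apply {q : Seminorm 𝕜 E} {φ : ℕ → E →L[𝕜] 𝕜} {c : ℕ → ℝ≥0}
    (hc : Summable c) (hφ : ∀ n x, ‖φ n x‖ ≤ c n * q x) (x : E) :
    Summable fun n => ‖φ n x‖ :=
  Summable.of_nonneg_of_le (fun _ => norm_nonneg _) (fun n => hφ n x)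
    ((NNReal.summable_coe.2 hc).mul_right (q x))

/-- Unpacked form of the axiom of `NuclearSpace`, with summability of the dominating series made
explicit. Pietsch 1972, Prop. 4.1.4. [cite: Pietsch1972, Prop. 4.1.4] -/
theorem exists_dominating [NuclearSpace 𝕜 E] (p : Seminorm 𝕜 E) (hp : Continuous p) :
    ∃ q : Seminorm 𝕜 E, Continuous q ∧ ∃ (φ : ℕ → E →L[𝕜] 𝕜) (c : ℕ → ℝ≥0),
      Summable c ∧ (∀ n x, ‖φ n x‖ ≤ c n * q x) ∧ (∀ x, Summable fun n => ‖φ n x‖) ∧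
        ∀ x, p x ≤ ∑' n, ‖φ n x‖ := by
  obtain ⟨q, hq, φ, c, hc, hφ, hpφ⟩ := NuclearSpace.exists_nuclear_dominating (𝕜 := 𝕜) p hp
  exact ⟨q, hq, φ, c, hc, hφ, summable_norm_apply hc hφ, hpφ⟩

/-- A finite-dimensional Hausdorff topological vector space is nuclear (dominate `p` by
`∑ᵢ p(eᵢ) |eᵢ*(x)|` for a basis `eᵢ`). Trèves 1967, §50, Example after Def. 50.1;
Pietsch 1972, 5.1. (`T2Space` is not needed for the Pietsch form — continuous seminorms factor
through the Hausdorff quotient — but is kept as the outline's signature.) [cite: Treves1967, §50  Example after Def. 50.1] -/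
def of_finiteDimensional : Prop :=
  ∀ [FiniteDimensional 𝕜 E] [IsTopologicalAddGroup E] [ContinuousSMul 𝕜 E] [T2Space E],
    NuclearSpace 𝕜 E

/-- The product of two nuclear spaces is nuclear. Pietsch 1972, Prop. 5.2.1;
Trèves 1967, Prop. 50.1 (50.7). [cite: Pietsch1972, Prop. 5.2.1] -/
def prod : Prop :=
  ∀ {F : Type*} [AddCommGroup F] [Module 𝕜 F] [TopologicalSpace F] [NuclearSpace 𝕜 E] [NuclearSpace 𝕜 F],
    NuclearSpace 𝕜 (E × F)

/-- A closed linear subspace of a *locally convex* nuclear space is nuclear (with the induced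
topology). Pietsch 1972, Prop. 5.1.1; Trèves 1967, Prop. 50.1 (50.3). Local convexity (stated in
Mathlib's `RCLike` idiom via the real structure, `LocallyConvexSpace ℝ E`) is essential: every
continuous seminorm on `S` must be dominated by the restriction of a continuous seminorm of `E`;
without it the statement fails (e.g. `L^p[0,1]`, `p < 1`, is vacuously "nuclear" but contains a
closed copy of `ℓ²`). Closedness of `S` is in fact superfluous and kept only as the customary
form. [cite: Pietsch1972, Prop. 5.1.1] -/
def of_closed_submodule : Prop :=
  ∀ [Module ℝ E] [IsScalarTower ℝ 𝕜 E] [IsTopologicalAddGroup E] [ContinuousSMul 𝕜 E] [LocallyConvexSpace ℝ E] [NuclearSpace 𝕜 E] (S : Submodule 𝕜 E) (hS : IsClosed (S : Set E)),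
    NuclearSpace 𝕜 S

end NuclearSpace

/-- An infinite-dimensional normed space is **not** nuclear: a nuclear seminorm dominating the
norm would make the identity a nuclear (hence compact) operator. Trèves 1967, Cor. 2 of
Prop. 50.2; sanity check that `ℓ²`, `L²` are not nuclear. [cite: Treves1967, Cor. 2 of Prop. 50.2] -/
def not_nuclearSpace_of_not_finiteDimensional : Prop :=
  ∀ {𝕜 : Type*} {E : Type*} [RCLike 𝕜] [NormedAddCommGroup E] [NormedSpace 𝕜 E] (h : ¬ FiniteDimensional 𝕜 E),
    ¬ NuclearSpace 𝕜 E

section Schwartz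

variable (E F : Type*) [NormedAddCommGroup E] [NormedSpace ℝ E] [NormedAddCommGroup F]
  [NormedSpace ℝ F]

/-- **The Schwartz space is nuclear.** For finite-dimensional `E`, `F`, the Fréchet space
`𝓢(E, F)` of rapidly decreasing smooth functions is a nuclear space. Grothendieck 1955, Ch. II
§2 no. 3; Trèves 1967, Thm 51.5; Gel'fand–Vilenkin IV, Ch. I §3.6 (via the Hermite expansion).
A theorem, deliberately not an instance. [cite: Grothendieck1955, Ch. II §2 no. 3] -/
def nuclearSpace_schwartzMap : Prop :=
  ∀ [FiniteDimensional ℝ E] [FiniteDimensional ℝ F],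
    NuclearSpace ℝ 𝓢(E, F)

/-- **The Schwartz space is separable**: for finite-dimensional `E`, `F` the Hermite functions
(tensored with a basis of `F`) have dense span in `𝓢(E, F)`. Gel'fand–Vilenkin IV, Ch. I §3.6;
Trèves 1967, remark after Thm 51.5; Reed–Simon I, Thm V.13. Mathlib has only
`SchwartzMap.instFirstCountableTopology` at the pin. A theorem, deliberately not an instance
(consumed via `haveI` by the Minlos item). [cite: Treves1967, remark after Thm 51.5] -/
def separableSpace_schwartzMap : Prop :=
  ∀ [FiniteDimensional ℝ E] [FiniteDimensional ℝ F],
    TopologicalSpace.SeparableSpace 𝓢(E, F)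

end Schwartz

end Nuclear

end Literature.Analysis.FunctionSpaces
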